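/-
Copyright (c) 2026 the pub-hodgecm-mathlib formalisation cell (harness21).  Prover seat hodgecm-mathlib-B-p14 (g32) — (R2) glue ∕ assembly heir, 2026-09-01.
«EP-RAM-E-PKG»: the tame-ramified (R2) package modulo the non-elliptic relation alone — B-p04 (g35)'s ★ ramified elliptic relation read at the levels of ★ «EP-RAM-PKG».
-/
import Literature.NumberTheory.Rogawski1990.RankOneEulerPoincareNonsplitRamifiedPackage   -- ★ (B-p14 g32) p843499: the package from (E),(N) at `(K♯_D, K, K♯_D ⊓ K)`
import Literature.NumberTheory.Automorphic.UnitaryTwoEulerPoincareEllipticRamified     -- ★ (B-p04 g35) p843501: `natCard_fixedBy_add_eq_natCard_fixedBy_add_one_of_isRegularElt_of_ramified`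
import HarnessLib

/-!
# The Euler–Poincaré package at a tamely ramified non-split place, modulo the non-elliptic relation

Topic `NumberTheory/Rogawski1990`, namespace `Literature.NumberTheory.Rogawski1990`.  THEOREMS ONLY: no definition, no named fact, no instance, no notation,
no `sorry`; kernel lane.  `L` CM, `v` non-split and TAMELY RAMIFIED in `L` (`w ∣ v`, `w̄ = w`, `e(w|v) ≠ 1`, `2 ∈ 𝒪_w^×`), `η ∈ L_w^×` ANY uniformiser
(`|η| = exp(−1)`; e.g. the anti-fixed one ★ `exists_uniformizer_galAdicCompletionMap_complexConj_eq_neg_of_ramified`), `D_η = diag(1, η)`, and on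
`U₂ = U(Φ₂)(L⁺_v)` the three levels of ★ «EP-RAM-PKG»: VERTEX stabiliser `K♯_η = (D_η GL₂(𝒪_w) D_η⁻¹).comap (U_w.subtype ∘ e_w)`, EDGE-midpoint stabiliser
`K = U(Φ₂)(𝒪_v)`, flag `K♯_η ⊓ K` [Serre1980Trees II.1.1, barycentric subdivision; A-p06 (g27) census (D1)–(D5)].  (§1) Kottwitz's ELLIPTIC relation
`#Fix(U₂⧸K♯_η) + #Fix(U₂⧸K) = #Fix(U₂⧸(K♯_η ⊓ K)) + 1` at every regular elliptic class = ★ B-p04 `natCard_fixedBy_add_eq_natCard_fixedBy_add_one_of_isRegularElt_of_ramified`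
(type-blind tree road: ★ A-p17 (T3)∕(T4), ★ A-p06 ramified (hA)(hB)(hI), ★ B-p08 place-blind instance, ★ B-p04 finiteness) at `C := K`, `C′ := K♯_η`, `I := K♯_η ⊓ K`, addends
commuted; (§2) hence the per-place package and (§3) the letter's body at `(L, v, ν, m)` MODULO THE NON-ELLIPTIC RELATION (N) at `(K♯_η, K, K♯_η ⊓ K)` alone
(A-p06 (g27) (N2): «fixed vertices = fixed edges per period of the split torus»).  With ★ `rankOneEulerPoincareNonsplit_of_ramified` (B-p14) the letter (R2) then rests on
(N)-ram at the tame places and on the wild ramified places `v ∣ 2` only.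
HONEST LABEL: HC_CM is proved only modulo the cell's remaining named inputs (hLiu418, h413) until rung 0 closes; this file is unconditional.

## References
* [Kottwitz1988] R. E. Kottwitz, *Tamagawa numbers*, Ann. of Math. 127 (1988), 629–646, §2 Theorem 2.
* [Serre1980Trees] J.-P. Serre, *Trees* (1980), Ch. II §1.1.
* [Rogawski1990] J. D. Rogawski, *Automorphic Representations of Unitary Groups in Three Variables* (1990), §12.6 p. 174.
-/

set_option autoImplicit false

noncomputable section

open scoped ValuativeRel Matrix MatrixGroups
open Matrix ValuativeRel NumberField IsDedekindDomain MulAction MeasureTheory Measure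

namespace Literature.NumberTheory.Rogawski1990

open Literature.NumberTheory.Automorphic Literature.NumberTheory.Automorphic.UnitaryGroup

section TameRamified

variable (L : Type) [Field L] [NumberField L] [IsCMField L] {v : HeightOneSpectrum (𝓞 ↥(maximalRealSubfield L))}
  (w : PlacesOver L v) (hw : IsCMField.complexConj L • w.1 = w.1)
  (he : v.asIdeal.ramificationIdx' w.1.asIdeal ≠ 1) (h2 : IsUnit (2 : 𝒪[(w.1.adicCompletion L)]))
  (η : (w.1.adicCompletion L)ˣ) (hη : Valued.v (η : w.1.adicCompletion L) = WithZero.exp (-1 : ℤ))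

/-! ## §1 (E) at `(K♯_η, K, K♯_η ⊓ K)` for every regular elliptic class, `v` tamely ramified -/

include hw he h2 hη in
/-- **KOTTWITZ'S ELLIPTIC RELATION AT THE RAMIFIED LEVELS OF «EP-RAM-PKG»**: `v` tamely ramified non-split, `η` a uniformiser of `L_w`; for every regular elliptic
`γ ∈ U(Φ₂)(L⁺_v)`: `#Fix(U₂⧸K♯_η, γ) + #Fix(U₂⧸K, γ) = #Fix(U₂⧸(K♯_η ⊓ K), γ) + 1` — ★ B-p04 `natCard_fixedBy_add_eq_natCard_fixedBy_add_one_of_isRegularElt_of_ramified` at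
`C := K` (★ `mem_localIntegralLevel_iff_of_smul_eq`), `C′ := K♯_η` (★ `mem_comap_map_conj_glInt_iff`), `I := K♯_η ⊓ K`, compact∕open ★ `isCompact_isOpen_cmLocalIntegralLevel` ∕ ★
`isCompact_isOpen_comap_map_conj_glInt`, then `add_comm`. [cite: Kottwitz1988, §2 Theorem 2] [cite: Serre1980Trees, II.1.1] -/
theorem epEllipticRelation_vertexEdgeLevels_of_ramified
    (γ : (cmDatum L 2 (Matrix.of fun i j : Fin 2 => if i.val + j.val + 1 = 2 then (1 : L) else 0)).Local v) (hreg : IsRegularElt (γ.val : GL (Fin 2) (UnitaryGroup.LocalRing L v))) (hc : CompactSpace (Subgroup.centralizer ({γ} : Set ((cmDatum L 2 (Matrix.of fun i j : Fin 2 => if i.val + j.val + 1 = 2 then (1 : L) else 0)).Local v)))) :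
      Nat.card (fixedBy ((cmDatum L 2 (Matrix.of fun i j : Fin 2 => if i.val + j.val + 1 = 2 then (1 : L) else 0)).Local v ⧸
          (((glInt 2 (w.1.adicCompletion L)).map (MulAut.conj (glDiagonal 2 (w.1.adicCompletion L) ![1, η])).toMonoidHom).comap
          (((unitaryGroupOfForm (galAdicCompletionMap (L := L) (IsCMField.complexConj L) hw)
            (placeForm (Matrix.of fun i j : Fin 2 => if i.val + j.val + 1 = 2 then (1 : L) else 0) w.1)).subtype.comp
            (localNonsplitEquiv (IsCMField.complexConj L) (Matrix.of fun i j : Fin 2 => if i.val + j.val + 1 = 2 then (1 : L) else 0)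
          (IsCMField.complexConj_ne_one L) w hw).toMonoidHom :
            (cmDatum L 2 (Matrix.of fun i j : Fin 2 => if i.val + j.val + 1 = 2 then (1 : L) else 0)).Local v →* GL (Fin 2) (w.1.adicCompletion L))))) γ) +
        Nat.card (fixedBy ((cmDatum L 2 (Matrix.of fun i j : Fin 2 => if i.val + j.val + 1 = 2 then (1 : L) else 0)).Local v ⧸
          cmLocalIntegralLevel L 2 (Matrix.of fun i j : Fin 2 => if i.val + j.val + 1 = 2 then (1 : L) else 0) v) γ) =
        Nat.card (fixedBy ((cmDatum L 2 (Matrix.of fun i j : Fin 2 => if i.val + j.val + 1 = 2 then (1 : L) else 0)).Local v ⧸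
          ((((glInt 2 (w.1.adicCompletion L)).map (MulAut.conj (glDiagonal 2 (w.1.adicCompletion L) ![1, η])).toMonoidHom).comap
          (((unitaryGroupOfForm (galAdicCompletionMap (L := L) (IsCMField.complexConj L) hw)
            (placeForm (Matrix.of fun i j : Fin 2 => if i.val + j.val + 1 = 2 then (1 : L) else 0) w.1)).subtype.comp
            (localNonsplitEquiv (IsCMField.complexConj L) (Matrix.of fun i j : Fin 2 => if i.val + j.val + 1 = 2 then (1 : L) else 0)
          (IsCMField.complexConj_ne_one L) w hw).toMonoidHom :
            (cmDatum L 2 (Matrix.of fun i j : Fin 2 => if i.val + j.val + 1 = 2 then (1 : L) else 0)).Local v →* GL (Fin 2) (w.1.adicCompletion L)))) ⊓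
            cmLocalIntegralLevel L 2 (Matrix.of fun i j : Fin 2 => if i.val + j.val + 1 = 2 then (1 : L) else 0) v)) γ) + 1 := by
  obtain ⟨hKc, hKo⟩ := isCompact_isOpen_cmLocalIntegralLevel L 2 (Matrix.of fun i j : Fin 2 => if i.val + j.val + 1 = 2 then (1 : L) else 0) v
  obtain ⟨hSc, hSo⟩ := isCompact_isOpen_comap_map_conj_glInt L w hw (glDiagonal 2 (w.1.adicCompletion L) ![1, η])
  have h := natCard_fixedBy_add_eq_natCard_fixedBy_add_one_of_isRegularElt_of_ramified L v w hw he h2 η hη _ _ _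
    (fun g => mem_localIntegralLevel_iff_of_smul_eq (IsCMField.complexConj L) 2 _ (IsCMField.complexConj_ne_one L) w hw g)
    (fun g => mem_comap_map_conj_glInt_iff L w hw (glDiagonal 2 (w.1.adicCompletion L) ![1, η]) g)
    (fun g => Subgroup.mem_inf.trans and_comm) hKo hKc hSo hSc γ hreg hc
  rw [add_comm] at h
  exact h

/-! ## §2 The per-place package at a tamely ramified place, modulo (N) -/

variable
  [MeasurableSpace ((cmDatum L 2 (Matrix.of fun i j : Fin 2 => if i.val + j.val + 1 = 2 then (1 : L) else 0)).Local v)]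
  [BorelSpace ((cmDatum L 2 (Matrix.of fun i j : Fin 2 => if i.val + j.val + 1 = 2 then (1 : L) else 0)).Local v)]
  [∀ γ : (cmDatum L 2 (Matrix.of fun i j : Fin 2 => if i.val + j.val + 1 = 2 then (1 : L) else 0)).Local v,
    MeasurableSpace (((cmDatum L 2 (Matrix.of fun i j : Fin 2 => if i.val + j.val + 1 = 2 then (1 : L) else 0)).Local v) ⧸
      Subgroup.centralizer ({γ} : Set ((cmDatum L 2 (Matrix.of fun i j : Fin 2 => if i.val + j.val + 1 = 2 then (1 : L) else 0)).Local v)))]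
  [∀ γ : (cmDatum L 2 (Matrix.of fun i j : Fin 2 => if i.val + j.val + 1 = 2 then (1 : L) else 0)).Local v,
    BorelSpace (((cmDatum L 2 (Matrix.of fun i j : Fin 2 => if i.val + j.val + 1 = 2 then (1 : L) else 0)).Local v) ⧸
      Subgroup.centralizer ({γ} : Set ((cmDatum L 2 (Matrix.of fun i j : Fin 2 => if i.val + j.val + 1 = 2 then (1 : L) else 0)).Local v)))]
  (ν : Measure ((cmDatum L 2 (Matrix.of fun i j : Fin 2 => if i.val + j.val + 1 = 2 then (1 : L) else 0)).Local v))
  [IsHaarMeasure ν] [ν.IsMulRightInvariant]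

omit [BorelSpace ((cmDatum L 2 (Matrix.of fun i j : Fin 2 => if i.val + j.val + 1 = 2 then (1 : L) else 0)).Local v)]
  [∀ γ : (cmDatum L 2 (Matrix.of fun i j : Fin 2 => if i.val + j.val + 1 = 2 then (1 : L) else 0)).Local v,
    BorelSpace (((cmDatum L 2 (Matrix.of fun i j : Fin 2 => if i.val + j.val + 1 = 2 then (1 : L) else 0)).Local v) ⧸
      Subgroup.centralizer ({γ} : Set ((cmDatum L 2 (Matrix.of fun i j : Fin 2 => if i.val + j.val + 1 = 2 then (1 : L) else 0)).Local v)))]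
  [IsHaarMeasure ν] [ν.IsMulRightInvariant] in
include hw he h2 hη in
/-- **THE (R2) RELATIONS PACKAGE AT A TAMELY RAMIFIED NON-SPLIT PLACE, MODULO THE NON-ELLIPTIC RELATION** at `(K♯_η, K, K♯_η ⊓ K)`: `∃ K₁ K₂ I, open ∧ compact ×3 ∧ (E) ∧ (N)`
= the per-place hypothesis of ★ `rankOneEulerPoincareNonsplit_of_relations` at `(L, v)`, from `hN` alone (★ «EP-RAM-PKG» `exists_epRelations_of_vertexEdgeLevels` with (E) := §1).
[cite: Kottwitz1988, §2 Theorem 2] [cite: Serre1980Trees, II.1.1] [cite: Rogawski1990, §12.6 p. 174] -/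
theorem exists_epRelations_of_ramified_of_nonEllipticRelation
    {m : OrbitalMeasureFamily ((cmDatum L 2 (Matrix.of fun i j : Fin 2 => if i.val + j.val + 1 = 2 then (1 : L) else 0)).Local v)}
    (hN : ∀ γ : (cmDatum L 2 (Matrix.of fun i j : Fin 2 => if i.val + j.val + 1 = 2 then (1 : L) else 0)).Local v,
      IsRegularElt (γ.val : GL (Fin 2) (UnitaryGroup.LocalRing L v)) →
      ¬ CompactSpace (Subgroup.centralizer ({γ} : Set ((cmDatum L 2 (Matrix.of fun i j : Fin 2 => if i.val + j.val + 1 = 2 then (1 : L) else 0)).Local v))) →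
      (((ν ((((glInt 2 (w.1.adicCompletion L)).map (MulAut.conj (glDiagonal 2 (w.1.adicCompletion L) ![1, η])).toMonoidHom).comap
          (((unitaryGroupOfForm (galAdicCompletionMap (L := L) (IsCMField.complexConj L) hw)
            (placeForm (Matrix.of fun i j : Fin 2 => if i.val + j.val + 1 = 2 then (1 : L) else 0) w.1)).subtype.comp
            (localNonsplitEquiv (IsCMField.complexConj L) (Matrix.of fun i j : Fin 2 => if i.val + j.val + 1 = 2 then (1 : L) else 0)
          (IsCMField.complexConj_ne_one L) w hw).toMonoidHom :
            (cmDatum L 2 (Matrix.of fun i j : Fin 2 => if i.val + j.val + 1 = 2 then (1 : L) else 0)).Local v →* GL (Fin 2) (w.1.adicCompletion L)))))).toReal : ℂ))⁻¹ *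
          classOrbitalIntegral m
            ((((((glInt 2 (w.1.adicCompletion L)).map (MulAut.conj (glDiagonal 2 (w.1.adicCompletion L) ![1, η])).toMonoidHom).comap
          (((unitaryGroupOfForm (galAdicCompletionMap (L := L) (IsCMField.complexConj L) hw)
            (placeForm (Matrix.of fun i j : Fin 2 => if i.val + j.val + 1 = 2 then (1 : L) else 0) w.1)).subtype.comp
            (localNonsplitEquiv (IsCMField.complexConj L) (Matrix.of fun i j : Fin 2 => if i.val + j.val + 1 = 2 then (1 : L) else 0)
          (IsCMField.complexConj_ne_one L) w hw).toMonoidHom :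
            (cmDatum L 2 (Matrix.of fun i j : Fin 2 => if i.val + j.val + 1 = 2 then (1 : L) else 0)).Local v →* GL (Fin 2) (w.1.adicCompletion L)))) : Subgroup ((cmDatum L 2 (Matrix.of fun i j : Fin 2 => if i.val + j.val + 1 = 2 then (1 : L) else 0)).Local v)) : Set ((cmDatum L 2 (Matrix.of fun i j : Fin 2 => if i.val + j.val + 1 = 2 then (1 : L) else 0)).Local v)).indicator fun _ => (1 : ℂ))
            (ConjClasses.mk γ) +
        (((ν (cmLocalIntegralLevel L 2 (Matrix.of fun i j : Fin 2 => if i.val + j.val + 1 = 2 then (1 : L) else 0) v)).toReal : ℂ))⁻¹ *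
          classOrbitalIntegral m
            (((cmLocalIntegralLevel L 2 (Matrix.of fun i j : Fin 2 => if i.val + j.val + 1 = 2 then (1 : L) else 0) v) : Set ((cmDatum L 2 (Matrix.of fun i j : Fin 2 => if i.val + j.val + 1 = 2 then (1 : L) else 0)).Local v)).indicator fun _ => (1 : ℂ))
            (ConjClasses.mk γ) -
        (((ν ((((glInt 2 (w.1.adicCompletion L)).map (MulAut.conj (glDiagonal 2 (w.1.adicCompletion L) ![1, η])).toMonoidHom).comap
          (((unitaryGroupOfForm (galAdicCompletionMap (L := L) (IsCMField.complexConj L) hw)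
            (placeForm (Matrix.of fun i j : Fin 2 => if i.val + j.val + 1 = 2 then (1 : L) else 0) w.1)).subtype.comp
            (localNonsplitEquiv (IsCMField.complexConj L) (Matrix.of fun i j : Fin 2 => if i.val + j.val + 1 = 2 then (1 : L) else 0)
          (IsCMField.complexConj_ne_one L) w hw).toMonoidHom :
            (cmDatum L 2 (Matrix.of fun i j : Fin 2 => if i.val + j.val + 1 = 2 then (1 : L) else 0)).Local v →* GL (Fin 2) (w.1.adicCompletion L)))) ⊓
            cmLocalIntegralLevel L 2 (Matrix.of fun i j : Fin 2 => if i.val + j.val + 1 = 2 then (1 : L) else 0) v)).toReal : ℂ))⁻¹ *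
          classOrbitalIntegral m
            ((((((glInt 2 (w.1.adicCompletion L)).map (MulAut.conj (glDiagonal 2 (w.1.adicCompletion L) ![1, η])).toMonoidHom).comap
          (((unitaryGroupOfForm (galAdicCompletionMap (L := L) (IsCMField.complexConj L) hw)
            (placeForm (Matrix.of fun i j : Fin 2 => if i.val + j.val + 1 = 2 then (1 : L) else 0) w.1)).subtype.comp
            (localNonsplitEquiv (IsCMField.complexConj L) (Matrix.of fun i j : Fin 2 => if i.val + j.val + 1 = 2 then (1 : L) else 0)
          (IsCMField.complexConj_ne_one L) w hw).toMonoidHom :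
            (cmDatum L 2 (Matrix.of fun i j : Fin 2 => if i.val + j.val + 1 = 2 then (1 : L) else 0)).Local v →* GL (Fin 2) (w.1.adicCompletion L)))) ⊓
              cmLocalIntegralLevel L 2 (Matrix.of fun i j : Fin 2 => if i.val + j.val + 1 = 2 then (1 : L) else 0) v : Subgroup ((cmDatum L 2 (Matrix.of fun i j : Fin 2 => if i.val + j.val + 1 = 2 then (1 : L) else 0)).Local v)) : Set ((cmDatum L 2 (Matrix.of fun i j : Fin 2 => if i.val + j.val + 1 = 2 then (1 : L) else 0)).Local v)).indicator fun _ => (1 : ℂ))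
            (ConjClasses.mk γ) = 0) :
    ∃ K K' I : Subgroup ((cmDatum L 2 (Matrix.of fun i j : Fin 2 => if i.val + j.val + 1 = 2 then (1 : L) else 0)).Local v),
      IsOpen (K : Set ((cmDatum L 2 (Matrix.of fun i j : Fin 2 => if i.val + j.val + 1 = 2 then (1 : L) else 0)).Local v)) ∧
      IsCompact (K : Set ((cmDatum L 2 (Matrix.of fun i j : Fin 2 => if i.val + j.val + 1 = 2 then (1 : L) else 0)).Local v)) ∧
      IsOpen (K' : Set ((cmDatum L 2 (Matrix.of fun i j : Fin 2 => if i.val + j.val + 1 = 2 then (1 : L) else 0)).Local v)) ∧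
      IsCompact (K' : Set ((cmDatum L 2 (Matrix.of fun i j : Fin 2 => if i.val + j.val + 1 = 2 then (1 : L) else 0)).Local v)) ∧
      IsOpen (I : Set ((cmDatum L 2 (Matrix.of fun i j : Fin 2 => if i.val + j.val + 1 = 2 then (1 : L) else 0)).Local v)) ∧
      IsCompact (I : Set ((cmDatum L 2 (Matrix.of fun i j : Fin 2 => if i.val + j.val + 1 = 2 then (1 : L) else 0)).Local v)) ∧
      (∀ γ : (cmDatum L 2 (Matrix.of fun i j : Fin 2 => if i.val + j.val + 1 = 2 then (1 : L) else 0)).Local v,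
        IsRegularElt (γ.val : GL (Fin 2) (UnitaryGroup.LocalRing L v)) →
        CompactSpace (Subgroup.centralizer
          ({γ} : Set ((cmDatum L 2 (Matrix.of fun i j : Fin 2 => if i.val + j.val + 1 = 2 then (1 : L) else 0)).Local v))) →
        Nat.card (fixedBy ((cmDatum L 2 (Matrix.of fun i j : Fin 2 => if i.val + j.val + 1 = 2 then (1 : L) else 0)).Local v ⧸ K) γ) +
          Nat.card (fixedBy ((cmDatum L 2 (Matrix.of fun i j : Fin 2 => if i.val + j.val + 1 = 2 then (1 : L) else 0)).Local v ⧸ K') γ) =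
          Nat.card (fixedBy ((cmDatum L 2 (Matrix.of fun i j : Fin 2 => if i.val + j.val + 1 = 2 then (1 : L) else 0)).Local v ⧸ I) γ) + 1) ∧
      (∀ γ : (cmDatum L 2 (Matrix.of fun i j : Fin 2 => if i.val + j.val + 1 = 2 then (1 : L) else 0)).Local v,
        IsRegularElt (γ.val : GL (Fin 2) (UnitaryGroup.LocalRing L v)) →
        ¬ CompactSpace (Subgroup.centralizer
          ({γ} : Set ((cmDatum L 2 (Matrix.of fun i j : Fin 2 => if i.val + j.val + 1 = 2 then (1 : L) else 0)).Local v))) →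
        (((ν K).toReal : ℂ))⁻¹ * classOrbitalIntegral m
            ((K : Set ((cmDatum L 2 (Matrix.of fun i j : Fin 2 => if i.val + j.val + 1 = 2 then (1 : L) else 0)).Local v)).indicator fun _ => (1 : ℂ))
            (ConjClasses.mk γ) +
          (((ν K').toReal : ℂ))⁻¹ * classOrbitalIntegral m
            ((K' : Set ((cmDatum L 2 (Matrix.of fun i j : Fin 2 => if i.val + j.val + 1 = 2 then (1 : L) else 0)).Local v)).indicator fun _ => (1 : ℂ))
            (ConjClasses.mk γ) -
          (((ν I).toReal : ℂ))⁻¹ * classOrbitalIntegral m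
            ((I : Set ((cmDatum L 2 (Matrix.of fun i j : Fin 2 => if i.val + j.val + 1 = 2 then (1 : L) else 0)).Local v)).indicator fun _ => (1 : ℂ))
            (ConjClasses.mk γ) = 0) :=
  exists_epRelations_of_vertexEdgeLevels L w hw (glDiagonal 2 (w.1.adicCompletion L) ![1, η]) ν
    (epEllipticRelation_vertexEdgeLevels_of_ramified L w hw he h2 η hη) hN

/-! ## §3 The Euler–Poincaré function at a tamely ramified place, modulo (N) -/

include hw he h2 hη in
/-- **KOTTWITZ'S EULER–POINCARÉ FUNCTION ON `U(Φ₂)(L⁺_v)` AT A TAMELY RAMIFIED NON-SPLIT PLACE, MODULO (N)**: for every two-sided Haar `ν` and canonical `m`, the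
non-elliptic relation at `(K♯_η, K, K♯_η ⊓ K)` gives `f ∈ C_c^∞(U₂)` with `Φ(⟦γ⟧, f) = 1` at every regular elliptic class and `= 0` at every regular non-elliptic class —
the body of ★ `RankOneEulerPoincareNonsplit` at `(L, v, ν, m)`, i.e. the tame part of the `hram` residue of ★ `rankOneEulerPoincareNonsplit_of_ramified`.
[cite: Kottwitz1988, §2 Theorem 2] [cite: Rogawski1990, §12.6 p. 174; §12.7 Lemma 12.7.1 p. 176] -/
theorem exists_isLocSmooth_classOrbitalIntegral_eq_one_zero_of_ramified_of_nonEllipticRelation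
    {m : OrbitalMeasureFamily ((cmDatum L 2 (Matrix.of fun i j : Fin 2 => if i.val + j.val + 1 = 2 then (1 : L) else 0)).Local v)}
    (hm : m.IsCanonical (fun γ => IsRegularElt (γ.val : GL (Fin 2) (UnitaryGroup.LocalRing L v))) ν)
    (hN : ∀ γ : (cmDatum L 2 (Matrix.of fun i j : Fin 2 => if i.val + j.val + 1 = 2 then (1 : L) else 0)).Local v,
      IsRegularElt (γ.val : GL (Fin 2) (UnitaryGroup.LocalRing L v)) →
      ¬ CompactSpace (Subgroup.centralizer ({γ} : Set ((cmDatum L 2 (Matrix.of fun i j : Fin 2 => if i.val + j.val + 1 = 2 then (1 : L) else 0)).Local v))) →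
      (((ν ((((glInt 2 (w.1.adicCompletion L)).map (MulAut.conj (glDiagonal 2 (w.1.adicCompletion L) ![1, η])).toMonoidHom).comap
          (((unitaryGroupOfForm (galAdicCompletionMap (L := L) (IsCMField.complexConj L) hw)
            (placeForm (Matrix.of fun i j : Fin 2 => if i.val + j.val + 1 = 2 then (1 : L) else 0) w.1)).subtype.comp
            (localNonsplitEquiv (IsCMField.complexConj L) (Matrix.of fun i j : Fin 2 => if i.val + j.val + 1 = 2 then (1 : L) else 0)
          (IsCMField.complexConj_ne_one L) w hw).toMonoidHom :
            (cmDatum L 2 (Matrix.of fun i j : Fin 2 => if i.val + j.val + 1 = 2 then (1 : L) else 0)).Local v →* GL (Fin 2) (w.1.adicCompletion L)))))).toReal : ℂ))⁻¹ *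
          classOrbitalIntegral m
            ((((((glInt 2 (w.1.adicCompletion L)).map (MulAut.conj (glDiagonal 2 (w.1.adicCompletion L) ![1, η])).toMonoidHom).comap
          (((unitaryGroupOfForm (galAdicCompletionMap (L := L) (IsCMField.complexConj L) hw)
            (placeForm (Matrix.of fun i j : Fin 2 => if i.val + j.val + 1 = 2 then (1 : L) else 0) w.1)).subtype.comp
            (localNonsplitEquiv (IsCMField.complexConj L) (Matrix.of fun i j : Fin 2 => if i.val + j.val + 1 = 2 then (1 : L) else 0)
          (IsCMField.complexConj_ne_one L) w hw).toMonoidHom :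
            (cmDatum L 2 (Matrix.of fun i j : Fin 2 => if i.val + j.val + 1 = 2 then (1 : L) else 0)).Local v →* GL (Fin 2) (w.1.adicCompletion L)))) : Subgroup ((cmDatum L 2 (Matrix.of fun i j : Fin 2 => if i.val + j.val + 1 = 2 then (1 : L) else 0)).Local v)) : Set ((cmDatum L 2 (Matrix.of fun i j : Fin 2 => if i.val + j.val + 1 = 2 then (1 : L) else 0)).Local v)).indicator fun _ => (1 : ℂ))
            (ConjClasses.mk γ) +
        (((ν (cmLocalIntegralLevel L 2 (Matrix.of fun i j : Fin 2 => if i.val + j.val + 1 = 2 then (1 : L) else 0) v)).toReal : ℂ))⁻¹ *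
          classOrbitalIntegral m
            (((cmLocalIntegralLevel L 2 (Matrix.of fun i j : Fin 2 => if i.val + j.val + 1 = 2 then (1 : L) else 0) v) : Set ((cmDatum L 2 (Matrix.of fun i j : Fin 2 => if i.val + j.val + 1 = 2 then (1 : L) else 0)).Local v)).indicator fun _ => (1 : ℂ))
            (ConjClasses.mk γ) -
        (((ν ((((glInt 2 (w.1.adicCompletion L)).map (MulAut.conj (glDiagonal 2 (w.1.adicCompletion L) ![1, η])).toMonoidHom).comap
          (((unitaryGroupOfForm (galAdicCompletionMap (L := L) (IsCMField.complexConj L) hw)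
            (placeForm (Matrix.of fun i j : Fin 2 => if i.val + j.val + 1 = 2 then (1 : L) else 0) w.1)).subtype.comp
            (localNonsplitEquiv (IsCMField.complexConj L) (Matrix.of fun i j : Fin 2 => if i.val + j.val + 1 = 2 then (1 : L) else 0)
          (IsCMField.complexConj_ne_one L) w hw).toMonoidHom :
            (cmDatum L 2 (Matrix.of fun i j : Fin 2 => if i.val + j.val + 1 = 2 then (1 : L) else 0)).Local v →* GL (Fin 2) (w.1.adicCompletion L)))) ⊓
            cmLocalIntegralLevel L 2 (Matrix.of fun i j : Fin 2 => if i.val + j.val + 1 = 2 then (1 : L) else 0) v)).toReal : ℂ))⁻¹ *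
          classOrbitalIntegral m
            ((((((glInt 2 (w.1.adicCompletion L)).map (MulAut.conj (glDiagonal 2 (w.1.adicCompletion L) ![1, η])).toMonoidHom).comap
          (((unitaryGroupOfForm (galAdicCompletionMap (L := L) (IsCMField.complexConj L) hw)
            (placeForm (Matrix.of fun i j : Fin 2 => if i.val + j.val + 1 = 2 then (1 : L) else 0) w.1)).subtype.comp
            (localNonsplitEquiv (IsCMField.complexConj L) (Matrix.of fun i j : Fin 2 => if i.val + j.val + 1 = 2 then (1 : L) else 0)
          (IsCMField.complexConj_ne_one L) w hw).toMonoidHom :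
            (cmDatum L 2 (Matrix.of fun i j : Fin 2 => if i.val + j.val + 1 = 2 then (1 : L) else 0)).Local v →* GL (Fin 2) (w.1.adicCompletion L)))) ⊓
              cmLocalIntegralLevel L 2 (Matrix.of fun i j : Fin 2 => if i.val + j.val + 1 = 2 then (1 : L) else 0) v : Subgroup ((cmDatum L 2 (Matrix.of fun i j : Fin 2 => if i.val + j.val + 1 = 2 then (1 : L) else 0)).Local v)) : Set ((cmDatum L 2 (Matrix.of fun i j : Fin 2 => if i.val + j.val + 1 = 2 then (1 : L) else 0)).Local v)).indicator fun _ => (1 : ℂ))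
            (ConjClasses.mk γ) = 0) :
    ∃ f : (cmDatum L 2 (Matrix.of fun i j : Fin 2 => if i.val + j.val + 1 = 2 then (1 : L) else 0)).Local v → ℂ, IsLocSmooth f ∧
      (∀ γ : (cmDatum L 2 (Matrix.of fun i j : Fin 2 => if i.val + j.val + 1 = 2 then (1 : L) else 0)).Local v,
          IsRegularElt (γ.val : GL (Fin 2) (UnitaryGroup.LocalRing L v)) →
          CompactSpace (Subgroup.centralizer ({γ} : Set ((cmDatum L 2 (Matrix.of fun i j : Fin 2 => if i.val + j.val + 1 = 2 then (1 : L) else 0)).Local v))) →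
          classOrbitalIntegral m f (ConjClasses.mk γ) = 1) ∧
      (∀ γ : (cmDatum L 2 (Matrix.of fun i j : Fin 2 => if i.val + j.val + 1 = 2 then (1 : L) else 0)).Local v,
          IsRegularElt (γ.val : GL (Fin 2) (UnitaryGroup.LocalRing L v)) →
          ¬ CompactSpace (Subgroup.centralizer ({γ} : Set ((cmDatum L 2 (Matrix.of fun i j : Fin 2 => if i.val + j.val + 1 = 2 then (1 : L) else 0)).Local v))) →
          classOrbitalIntegral m f (ConjClasses.mk γ) = 0) :=
  exists_isLocSmooth_classOrbitalIntegral_eq_one_zero_of_vertexEdgeLevels L w hw (glDiagonal 2 (w.1.adicCompletion L) ![1, η]) ν hm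
    (epEllipticRelation_vertexEdgeLevels_of_ramified L w hw he h2 η hη) hN

end TameRamified

end Literature.NumberTheory.Rogawski1990

end
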